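import Summits.BirchSwinnertonDyer.Rank1Residual.X11b.ShapiroPairs
import HarnessLib

/-!
# BSD rank-≤1 residual cell, class X9: `BSD(E,5)` by a full `5`-descent for `5S4` pairs, part D — the TRANSPORT PARTNERS of gen 15 (`8092e1`), class group ZIMMERT-certified

HONEST FRAMING (cell `b2b-bsdres-*`, verbatim): the cell deletes COMBINATION-SHAPED residual classes of
the rank-≤1 BSD formula from PUBLISHED theorems only and TYPES the construction-shaped remainder; this
is not "finishing BSD". Class X9 stays TYPED at class level; everything here is PER PAIR; no lane
verdict is changed; no named fact; nothing is booked by this unit (the lane books, the referee rules).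

Unit `b2b-bsdres-x9`, gen 15. Part D of `X9/S4DescentPairsZimmert{A,B,C}.lean` (gen 14; method, engine provenance and
theorem shape identical: x11c gen-13 engine `s4desc` — Schaefer–Stoll `5`-descent over the degree-`24` field `R = ℚ(T′)` of a
`5`-torsion point, image ENFORCED by the subfield lattice of `R`, `K_S(R)` contamination check, local images, `5`-saturation
by quintic characters, Galois action proved by characters; method note `HOME/b2b-bsdres-x11c/gen13/S4DESCENT-METHOD.md` —
BYTE COPIES run by this unit with the engine's independent verifier; PARI's `bnfinit` class group made UNCONDITIONAL by a
ZIMMERT certificate, Bordellès 2012 Thm. 7.51, x11c gen-13 kit byte copies). The curves here are the rank-ONE PARTNERS of the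
Greenberg–Vatsal transport records of `X9/TransportPairs{,B,C}.lean`: a kernel `BSDp` for the partner turns the transport
record's binder `hbsdA` into a theorem (`X9/TransportPairsD.lean`). What enters the kernel per pair is ONE line
`hSel : #Sel^(5)(E/ℚ) = 5 ^ r_an` of x11c's class-free consumer `X11b.bsdp_of_ainvs_of_card_selmerGroup` (GZK `hGZK`,
`r_an ≤ 1`, `5 ∤ #Ш_an` ⟹ Miller's `BSDp`; `Δ ≠ 0` decided in the kernel). Non-kernel inputs displayed as binders: `hGZK`
(published), `r_an ≤ 1` and `#Ш_an` (Cremona / the cell's engines), `hSel` (the certificate line, status stated per pair).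

References: E. F. Schaefer, M. Stoll, Trans. AMS 356 (2004) §2–3; O. Bordellès, *Arithmetic Tales* (2012) Thm. 7.51
(Zimmert); J. H. Silverman, *AEC* (2009) X.1, X.4 [SilvermanAEC2009]; R. L. Miller, LMS JCM 14 (2011) §1 [Miller2011LMS];
Cremona's tables [Cremona2006].
-/

set_option autoImplicit false

noncomputable section

open scoped Classical

open WeierstrassCurve Literature.NumberTheory.EllipticCurves
  Literature.NumberTheory.EllipticCurves.Rank1Residual
  Literature.NumberTheory.EllipticCurves.Rank1Residual.Typed
  Summit.BirchSwinnertonDyer.Rank1Residual.X11b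

namespace Summit.BirchSwinnertonDyer.Rank1Residual.X9

/-- **`BSD(E,5)` for `8092e1`** (`N = 8092 = 2²·7·17²`, good ordinary at `5`, class X9; Cremona model `[0, 0, 0, -4913, 2088025]`; `ρ̄_{E,5}` of
EXCEPTIONAL type `5S4`; rank `1`, `#Ш_an = 1`; c₂ = 3 (IV), c₇ = 1 (I5), c₁₇ = 3 (IV*)). Heegner-index route of record (x9 fold):
CERT (`D = -47`, `m = 18`, `5 ∤ m`, two engines; unflagged). Rank-ONE transport PARTNER of the open N3 cell `199988e1` (`X9/TransportPairsB.lean`, `bsdp_t199988e1_of_bsdp_s8092e1`): this theorem discharges that record's binder `hbsdA`. Here a SECOND, INDEPENDENT method for the same pair: GZK and the certificate line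
`#Sel^(5)(E/ℚ) = 5 ^ r_an` — full `5`-descent over `R = ℚ(E[5]∖0)` (degree `24`; x11c gen-13 engine `s4desc`, byte copies;
run of record + independent verifier by unit `b2b-bsdres-x9` gen 15, kit j127696; certificate
`HOME/b2b-bsdres-x9/g15/desc5s4/j127696/certs/cert_8092e1.txt.gz`): `S = [2, 5, 7, 17]`, `#gens R(S,5) = 27`, `5`-saturation
`[1, 93, 27]`, `dim K_S(R) = 0`, all local images complete, Galois action proved by characters,
**`dim_𝔽₅ Sel^(5)(E/ℚ) = 1`** with the Kummer image of the generator `[[0,1445]]` its non-zero element (exact 5th root exhibited / in Fake / non-zero); verifier: VERIFIED; the class group of `R` (`bnfinit`: `Cl(R) = [1, []]`, `Cl_S(R) = [1, []]`) CERTIFIED UNCONDITIONALLY by a Zimmert certificate (Bordellès Thm. 7.51 bound `Z = 949231`; every prime ideal of norm `≤ Z` decomposed on PARI's generators and verified exactly, up to the free action of `Aut(R) ≅ C₄` on degree-1 primes; 74682 ideals, 0 failures; so `Cl(R)` is a quotient of `[]` (PARI's cycle structure), generated by the exactly verified classes of the `S`-primes, hence `Cl_S(R) = 1`; kit j127706,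 0.04 core-h) — this certificate line is UNCONDITIONAL.
Binders: `hGZK`, `r_an ≤ 1`, `#Ш_an` a `5`-adic unit, `hSel`. Kernel: `Δ ≠ 0`.
[cite: Miller2011LMS, §1 and Def. 1.1] [cite: Cremona2006, Table 1 (Cremona label 8092e1)] -/
theorem bsdp_s8092e1 (hGZK : rank_eq_analyticRank_of_analyticRank_le_one)
    (W : WeierstrassCurve ℚ) (hW : W = ⟨0, 0, 0, -4913, 2088025⟩)
    (hr : W.analyticRank ≤ 1) {q : ℚ} (hq : shaAn W = (q : ℂ)) (hv : padicValRat 5 q = 0)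
    (hSel : Nat.card (W.selmerGroup (5 : ℤ)) = 5 ^ W.analyticRank) : BSDp W 5 := by
  subst hW
  haveI : Fact (Nat.Prime 5) := ⟨by norm_num⟩
  exact bsdp_of_ainvs_of_card_selmerGroup hGZK 0 0 0 (-4913) 2088025 (by decide +kernel) 5
    hr hq hv hSel

end Summit.BirchSwinnertonDyer.Rank1Residual.X9

end
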